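import Mathlib.Analysis.InnerProductSpace.Basic
import Mathlib.Algebra.BigOperators.Group.Finset.Basic
import HarnessLib

/-!
# Self-stresses of a point configuration and the prestress energy identity

A **self-stress** (equilibrium stress) of a finite point configuration `x : ι → V` is a symmetric
weight `σ i j = σ j i` on pairs with `∑ⱼ σ i j • (x j - x i) = 0` at every node (Connelly–Whiteley
1996, §2.1: "a stress ω is a self-stress if at every vertex the weighted sum of the edge vectors
vanishes").  Two consequences used by every "prestress stability" argument (op. cit. §3, the stress
energy `E_ω`) are recorded:

* `IsSelfStress.sum_mul_inner_eq_zero` : a self-stress annihilates the linearised squared-length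
  changes of EVERY displacement field `u`: `∑ᵢⱼ σ i j ⟪x j - x i, u j - u i⟫ = 0`;
* `IsSelfStress.sum_mul_sub_eq` : hence it pairs with the EXACT squared-length changes to the stress
  energy: `∑ᵢⱼ σ i j (‖(x+u) j - (x+u) i‖² - ‖x j - x i‖²) = ∑ᵢⱼ σ i j ‖u j - u i‖²`;
* `prestress_energy_identity` : the **calibration identity** — if the "prestress" weights `w` of a
  pair energy `∑ᵢⱼ φ i j (‖y j - y i‖²)` are decomposed as a sum of self-stresses `w = ∑ₖ σ k` and
  `β` are shares with `∑ₖ β k i j = 1`, then the energy difference between `x + u` and `x` equals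
  `∑ₖ ∑ᵢⱼ [σ k i j ‖u j - u i‖² + β k i j · B i j]`, `B` the Bregman remainder
  `φ(s') - φ(s) - w (s' - s)` — an exact, frame-free regrouping of a pair energy into per-index
  calibrated pieces (no smallness of `u`);
* `IsSelfStress.sum_mul_inner_map_eq_zero`, `IsSelfStress.sum_mul_norm_sq_affine_eq_zero` : the
  ZERO MOMENT of a self-stress — the stress energy vanishes on every affine field `L x + c`, so it is
  blind to rigid motions and to any affine change of frame.

All sums run over ordered pairs `(i, j)` of a `Fintype` (each unordered pair twice; non-edges are
the pairs of weight `0`); `V` is any real inner product space.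

## References
* R. Connelly, W. Whiteley, *Second-order rigidity and prestress stability for tensegrity
  frameworks*, SIAM J. Discrete Math. 9 (1996) 453–491, §2–3. [ConnellyWhiteley1996]
-/

namespace Literature.Geometry.DiscreteGeometry

open scoped BigOperators RealInnerProductSpace

variable {ι : Type*} [Fintype ι] {V : Type*} [NormedAddCommGroup V] [InnerProductSpace ℝ V]

/-- **Self-stress** of the configuration `x : ι → V`: a symmetric weight on ordered pairs in
equilibrium at every node, `∑ⱼ σ i j • (x j - x i) = 0`. [cite: ConnellyWhiteley1996, §2.1] -/
def IsSelfStress (x : ι → V) (σ : ι → ι → ℝ) : Prop :=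
  (∀ i j, σ i j = σ j i) ∧ ∀ i, ∑ j, σ i j • (x j - x i) = 0

namespace IsSelfStress

variable {x : ι → V} {σ : ι → ι → ℝ}

/-- Symmetry of a self-stress. [cite: ConnellyWhiteley1996, §2.1] -/
theorem symm (h : IsSelfStress x σ) (i j : ι) : σ i j = σ j i := h.1 i j

/-- Node equilibrium of a self-stress. [cite: ConnellyWhiteley1996, §2.1] -/
theorem sum_smul_sub_eq_zero (h : IsSelfStress x σ) (i : ι) : ∑ j, σ i j • (x j - x i) = 0 := h.2 i

/-- **A self-stress annihilates linearised length changes**: for every displacement field `u`,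
`∑ᵢ ∑ⱼ σ i j ⟪x j - x i, u j - u i⟫ = 0`. [cite: ConnellyWhiteley1996, §3] -/
theorem sum_mul_inner_eq_zero (h : IsSelfStress x σ) (u : ι → V) :
    ∑ i, ∑ j, σ i j * ⟪x j - x i, u j - u i⟫ = 0 := by
  -- `∑ⱼ σ i j ⟪x j - x i, v⟫ = ⟪∑ⱼ σ i j • (x j - x i), v⟫ = 0` for every fixed vector `v`
  have hnode : ∀ (i : ι) (v : V), ∑ j, σ i j * ⟪x j - x i, v⟫ = 0 := by
    intro i v
    have h1 : ∑ j, σ i j * ⟪x j - x i, v⟫ = ⟪∑ j, σ i j • (x j - x i), v⟫ := by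
      rw [sum_inner]
      exact Finset.sum_congr rfl fun j _ => (real_inner_smul_left _ _ _).symm
    rw [h1, h.sum_smul_sub_eq_zero i, inner_zero_left]
  -- split `⟪b, u j - u i⟫ = ⟪b, u j⟫ - ⟪b, u i⟫`
  have hsplit : ∑ i, ∑ j, σ i j * ⟪x j - x i, u j - u i⟫ =
      ∑ i, ∑ j, σ i j * ⟪x j - x i, u j⟫ - ∑ i, ∑ j, σ i j * ⟪x j - x i, u i⟫ := by
    rw [← Finset.sum_sub_distrib]
    refine Finset.sum_congr rfl fun i _ => ?_
    rw [← Finset.sum_sub_distrib]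
    refine Finset.sum_congr rfl fun j _ => ?_
    rw [inner_sub_right, mul_sub]
  -- the second double sum vanishes node by node
  have h2 : ∑ i, ∑ j, σ i j * ⟪x j - x i, u i⟫ = 0 :=
    Finset.sum_eq_zero fun i _ => hnode i (u i)
  -- the first one too, after swapping the summations and using symmetry
  have h3 : ∑ i, ∑ j, σ i j * ⟪x j - x i, u j⟫ = 0 := by
    rw [Finset.sum_comm]
    refine Finset.sum_eq_zero fun j _ => ?_
    have : ∑ i, σ i j * ⟪x j - x i, u j⟫ = -∑ i, σ j i * ⟪x i - x j, u j⟫ := by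
      rw [← Finset.sum_neg_distrib]
      refine Finset.sum_congr rfl fun i _ => ?_
      rw [h.symm i j, ← neg_sub (x j) (x i), inner_neg_left]
      ring
    rw [this, hnode j (u j), neg_zero]
  rw [hsplit, h2, h3, sub_zero]

/-- **Stress energy**: a self-stress pairs with the EXACT squared-length changes of a displacement
`u` to `∑ᵢⱼ σ i j ‖u j - u i‖²`. [cite: ConnellyWhiteley1996, §3] -/
theorem sum_mul_sub_eq (h : IsSelfStress x σ) (u : ι → V) :
    ∑ i, ∑ j, σ i j * (‖(x j + u j) - (x i + u i)‖ ^ 2 - ‖x j - x i‖ ^ 2) =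
      ∑ i, ∑ j, σ i j * ‖u j - u i‖ ^ 2 := by
  have key : ∀ i j, ‖(x j + u j) - (x i + u i)‖ ^ 2 - ‖x j - x i‖ ^ 2 =
      2 * ⟪x j - x i, u j - u i⟫ + ‖u j - u i‖ ^ 2 := by
    intro i j
    have e : (x j + u j) - (x i + u i) = (x j - x i) + (u j - u i) := by abel
    rw [e, norm_add_sq_real]
    ring
  have h0 := h.sum_mul_inner_eq_zero u
  calc ∑ i, ∑ j, σ i j * (‖(x j + u j) - (x i + u i)‖ ^ 2 - ‖x j - x i‖ ^ 2)
      = ∑ i, ∑ j, (2 * (σ i j * ⟪x j - x i, u j - u i⟫) + σ i j * ‖u j - u i‖ ^ 2) := by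
        refine Finset.sum_congr rfl fun i _ => Finset.sum_congr rfl fun j _ => ?_
        rw [key]; ring
    _ = 2 * ∑ i, ∑ j, σ i j * ⟪x j - x i, u j - u i⟫ + ∑ i, ∑ j, σ i j * ‖u j - u i‖ ^ 2 := by
        rw [Finset.mul_sum, ← Finset.sum_add_distrib]
        refine Finset.sum_congr rfl fun i _ => ?_
        rw [Finset.mul_sum, ← Finset.sum_add_distrib]
    _ = ∑ i, ∑ j, σ i j * ‖u j - u i‖ ^ 2 := by rw [h0, mul_zero, zero_add]

end IsSelfStress

/-- **Prestress energy identity (calibration identity).**  Pair energy `∑ᵢⱼ φ i j (‖y j - y i‖²)`,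
reference `x`, displacement `u`, prestress weights `w` decomposed as a SUM OF SELF-STRESSES
`∑ₖ σ k i j = w i j`, and shares `β` with `∑ₖ β k i j = 1`.  Then the energy difference is the sum
over `k` of the calibrated pieces `∑ᵢⱼ [σ k i j ‖u j - u i‖² + β k i j · B i j]` with the Bregman
remainder `B i j = φ i j (s' i j) - φ i j (s i j) - w i j (s' i j - s i j)` — exactly, for every `u`.
[cite: ConnellyWhiteley1996, §3] -/
theorem prestress_energy_identity {κ : Type*} [Fintype κ] (x u : ι → V) (φ : ι → ι → ℝ → ℝ)
    (w : ι → ι → ℝ) (σ β : κ → ι → ι → ℝ) (hσ : ∀ k, IsSelfStress x (σ k))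
    (hw : ∀ i j, ∑ k, σ k i j = w i j) (hβ : ∀ i j, ∑ k, β k i j = 1) :
    ∑ i, ∑ j, (φ i j (‖(x j + u j) - (x i + u i)‖ ^ 2) - φ i j (‖x j - x i‖ ^ 2)) =
      ∑ k, ∑ i, ∑ j, (σ k i j * ‖u j - u i‖ ^ 2 +
        β k i j * (φ i j (‖(x j + u j) - (x i + u i)‖ ^ 2) - φ i j (‖x j - x i‖ ^ 2) -
          w i j * (‖(x j + u j) - (x i + u i)‖ ^ 2 - ‖x j - x i‖ ^ 2))) := by
  -- abbreviations
  set s' : ι → ι → ℝ := fun i j => ‖(x j + u j) - (x i + u i)‖ ^ 2 with hs'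
  set s : ι → ι → ℝ := fun i j => ‖x j - x i‖ ^ 2 with hs
  -- the stress part: `∑ₖ ∑ᵢⱼ σ k ‖δu‖² = ∑ᵢⱼ w (s' - s)`
  have hstress : ∑ k, ∑ i, ∑ j, σ k i j * ‖u j - u i‖ ^ 2 = ∑ i, ∑ j, w i j * (s' i j - s i j) := by
    have h1 : ∀ k, ∑ i, ∑ j, σ k i j * ‖u j - u i‖ ^ 2 = ∑ i, ∑ j, σ k i j * (s' i j - s i j) :=
      fun k => ((hσ k).sum_mul_sub_eq u).symm
    rw [Finset.sum_congr rfl fun k _ => h1 k, Finset.sum_comm]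
    refine Finset.sum_congr rfl fun i _ => ?_
    rw [Finset.sum_comm]
    refine Finset.sum_congr rfl fun j _ => ?_
    rw [← Finset.sum_mul, hw i j]
  -- the Bregman part: the shares sum to one
  have hbreg : ∑ k, ∑ i, ∑ j, β k i j * (φ i j (s' i j) - φ i j (s i j) - w i j * (s' i j - s i j)) =
      ∑ i, ∑ j, (φ i j (s' i j) - φ i j (s i j) - w i j * (s' i j - s i j)) := by
    rw [Finset.sum_comm]
    refine Finset.sum_congr rfl fun i _ => ?_
    rw [Finset.sum_comm]
    refine Finset.sum_congr rfl fun j _ => ?_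
    rw [← Finset.sum_mul, hβ i j, one_mul]
  have hsplit : ∑ k, ∑ i, ∑ j, (σ k i j * ‖u j - u i‖ ^ 2 +
      β k i j * (φ i j (s' i j) - φ i j (s i j) - w i j * (s' i j - s i j))) =
      ∑ k, ∑ i, ∑ j, σ k i j * ‖u j - u i‖ ^ 2 +
        ∑ k, ∑ i, ∑ j, β k i j * (φ i j (s' i j) - φ i j (s i j) - w i j * (s' i j - s i j)) := by
    rw [← Finset.sum_add_distrib]
    refine Finset.sum_congr rfl fun k _ => ?_
    rw [← Finset.sum_add_distrib]
    refine Finset.sum_congr rfl fun i _ => ?_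
    rw [← Finset.sum_add_distrib]
  show ∑ i, ∑ j, (φ i j (s' i j) - φ i j (s i j)) = _
  rw [hsplit, hstress, hbreg, ← Finset.sum_add_distrib]
  refine Finset.sum_congr rfl fun i _ => ?_
  rw [← Finset.sum_add_distrib]
  refine Finset.sum_congr rfl fun j _ => ?_
  ring

/-! ## Zero moment: the stress energy is blind to affine changes of frame -/

namespace IsSelfStress

variable {x : ι → V} {σ : ι → ι → ℝ}

/-- **A self-stress annihilates linearised length changes, mapped version**: for every linear map
`P` and every field `u`, `∑ᵢ ∑ⱼ σ i j ⟪P (x j - x i), u j - u i⟫ = 0` (equilibrium at the nodes is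
preserved by `P`).  With `u = Q ∘ x` this is the vanishing of the MOMENT TENSOR
`∑ᵢⱼ σ i j (x j - x i) ⊗ (x j - x i)` of a self-stress, tested against `Pᵀ Q`.
[cite: ConnellyWhiteley1996, §3] -/
theorem sum_mul_inner_map_eq_zero (h : IsSelfStress x σ) (P : V →ₗ[ℝ] V) (u : ι → V) :
    ∑ i, ∑ j, σ i j * ⟪P (x j - x i), u j - u i⟫ = 0 := by
  -- `∑ⱼ σ i j ⟪P (x j - x i), v⟫ = ⟪P (∑ⱼ σ i j • (x j - x i)), v⟫ = 0`
  have hnode : ∀ (i : ι) (v : V), ∑ j, σ i j * ⟪P (x j - x i), v⟫ = 0 := by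
    intro i v
    have h1 : ∑ j, σ i j * ⟪P (x j - x i), v⟫ = ⟪P (∑ j, σ i j • (x j - x i)), v⟫ := by
      rw [map_sum, sum_inner]
      refine Finset.sum_congr rfl fun j _ => ?_
      rw [map_smul, real_inner_smul_left]
    rw [h1, h.sum_smul_sub_eq_zero i, map_zero, inner_zero_left]
  have hsplit : ∑ i, ∑ j, σ i j * ⟪P (x j - x i), u j - u i⟫ =
      ∑ i, ∑ j, σ i j * ⟪P (x j - x i), u j⟫ - ∑ i, ∑ j, σ i j * ⟪P (x j - x i), u i⟫ := by
    rw [← Finset.sum_sub_distrib]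
    refine Finset.sum_congr rfl fun i _ => ?_
    rw [← Finset.sum_sub_distrib]
    refine Finset.sum_congr rfl fun j _ => ?_
    rw [inner_sub_right, mul_sub]
  have h2 : ∑ i, ∑ j, σ i j * ⟪P (x j - x i), u i⟫ = 0 :=
    Finset.sum_eq_zero fun i _ => hnode i (u i)
  have h3 : ∑ i, ∑ j, σ i j * ⟪P (x j - x i), u j⟫ = 0 := by
    rw [Finset.sum_comm]
    refine Finset.sum_eq_zero fun j _ => ?_
    have : ∑ i, σ i j * ⟪P (x j - x i), u j⟫ = -∑ i, σ j i * ⟪P (x i - x j), u j⟫ := by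
      rw [← Finset.sum_neg_distrib]
      refine Finset.sum_congr rfl fun i _ => ?_
      rw [h.symm i j, ← neg_sub (x j) (x i), map_neg, inner_neg_left]
      ring
    rw [this, hnode j (u j), neg_zero]
  rw [hsplit, h2, h3, sub_zero]

/-- **Zero moment ⇒ the stress energy vanishes on affine fields**: for a self-stress and every
linear map `L` and vector `c`, `∑ᵢ ∑ⱼ σ i j ‖(L (x j) + c) - (L (x i) + c)‖² = 0` — the stress
energy of a prestress-stable framework does not see rigid motions, nor any affine change of frame
(Connelly–Whiteley: a proper self-stress has zero moment). [cite: ConnellyWhiteley1996, §3] -/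
theorem sum_mul_norm_sq_affine_eq_zero (h : IsSelfStress x σ) (L : V →ₗ[ℝ] V) (c : V) :
    ∑ i, ∑ j, σ i j * ‖(L (x j) + c) - (L (x i) + c)‖ ^ 2 = 0 := by
  have key : ∀ i j, ‖(L (x j) + c) - (L (x i) + c)‖ ^ 2 = ⟪L (x j - x i), L (x j) - L (x i)⟫ := by
    intro i j
    have e : (L (x j) + c) - (L (x i) + c) = L (x j - x i) := by rw [map_sub]; abel
    rw [e, ← real_inner_self_eq_norm_sq, map_sub]
  simp_rw [key]
  exact h.sum_mul_inner_map_eq_zero L (fun i => L (x i))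

end IsSelfStress

end Literature.Geometry.DiscreteGeometry
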